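import Mathlib
import Literature.MathematicalPhysics.QuantumLattice.HubbardBandSectorCountingToolbox
import Summits.HubbardSuperconductivity.HubbardSuperconductivity.Theorems.KLProgrammeKLRegimeTwoPointLimitShellAngularCaustic
import HarnessLib

/-!
# Route `KLProgramme` — crux K3 `KLRegimeTwoPointLimit` (stmt-HubbardSuperconductivity-19937), support:
# the angular measure bound of Lemma E.3 at the `2k_F` caustic (DECOMP App. E, assembly)

Cell `gate-hubbard-kl`, seat p1b; paper note `HOME/prover-p1b/E1-NOTE.md` §3 (assembly (ii), caustic
regime). For a transfer `w` at torus distance `≥ v` from the Cooper point — and possibly ON the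
caustic `2F_μ + 2πℤ²`, where `F_μ` and `F_μ + w` kiss — the sublevel set
`T = {θ ∈ [θ₀, θ₀ + 2π] : |ε(p_μ(θ) - w) - μ| ≤ δ}` satisfies

  `|T| ≤ 3(2π/ℓ + 25)·(δ/λ) + 12·6·√(δ/c)`           (`klsh_volume_sublevel_le_caustic`),

with `λ, ℓ, c` constants of the window geometry (fields of `BandBounds`): GOOD points of `T` (slope
`≥ 2λ` on the `δ/2λ`-ball around them inside `T`) are within `δ/2λ` of a zero (local descent
`klsg_exists_zero_near`), and the zeros of the three periods around `[θ₀, θ₀ + 2π]` number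
`≤ 3(2π/ℓ + 25)` (`klsd_zeros_card_le_awayFromCooper`); BAD points are within `δ/2λ` of a
near-tangent point, hence (`klsg_nearTangent_near_caustic`) their `2p_μ` is within `ρ₂` of one of
`≤ 4` caustic translates `w - 2πm`, and each such family has measure `≤ 3·6√(δ/c)` by the
square-root cap on the strictly convex windows (`klsg_window_volume_le`). This is the `ε₂^{1/2}` law
of Lemma E.3: the particle–hole bubble at transfer `2k_F` gains `γ^{j/2}` per scale — no logarithmic
flow at the caustic in `d = 2`.
-/

noncomputable section

-- the tree's namespace `Summit.<Summit>.<Problem>.Theorems` repeats the summit name by design (D-0017)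
set_option linter.dupNamespace false

open Real Set MeasureTheory
open scoped ENNReal
open Literature.MathematicalPhysics.QuantumLattice
open Literature.MathematicalPhysics.QuantumLattice.BandSectorCounting

namespace Summit.HubbardSuperconductivity.HubbardSuperconductivity.Theorems

section Main

variable {a b : ℝ} (B : BandBounds a b) {μ : ℝ} (hμ : μ ∈ Icc a b)
include B hμ

/-- **Angular bound, caustic regime (Lemma E.3).** See the module docstring; all hypotheses are
explicit inequalities between the parameters `(η, λ, v, δ, ℓ, η₁, ρ₂)` and the fields of `BandBounds`
(in the final constants they hold for `δ ≤ δ_*(B)` with `λ, ℓ, η, η₁, ρ₂` fixed multiples of `δ_*`). -/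
theorem klsh_volume_sublevel_le_caustic {η lam v δ ℓ η₁ ρ₂ w₁ w₂ θ₀ : ℝ}
    (hlo : a ≤ μ - η) (hhi : μ + η ≤ b) (hδη : δ ≤ η) (hδ : 0 < δ) (hlam : 0 < lam)
    (hδl : δ / (2 * lam) ≤ 2 * π)
    (hv : ∀ m₀ m₁ : ℤ, v ≤ max |w₁ - m₀ * (2 * π)| |w₂ - m₁ * (2 * π)|)
    (hH1 : B.smax * (B.Cg * (lam + 2 * B.smax * (η / B.Dtmin))) + η / B.Dtmin < v)
    (hρ₂ : B.smax * (B.Cg * (lam + 2 * B.smax * (η / B.Dtmin))) +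
        B.A2 / 4 * (B.Cg * (lam + 2 * B.smax * (η / B.Dtmin))) ^ 2 + η / B.Dtmin +
        2 * B.smax * (δ / (2 * lam)) ≤ ρ₂)
    (hlo₁ : a ≤ μ - η₁) (hhi₁ : μ + η₁ ≤ b) (hℓ : 0 < ℓ) (hηℓ : 4 * B.smax * ℓ ≤ η₁)
    (hH1c : B.smax * (B.Cg * (2 * B.smax * (η₁ / B.Dtmin))) + η₁ / B.Dtmin < v)
    (hρ₂c : B.smax * (B.Cg * (2 * B.smax * (η₁ / B.Dtmin))) +
        B.A2 / 4 * (B.Cg * (2 * B.smax * (η₁ / B.Dtmin))) ^ 2 + η₁ / B.Dtmin + 2 * B.smax * ℓ ≤ ρ₂)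
    (hσ : ρ₂ / (Real.sqrt 2 * B.umin) < 2)
    (hc : 0 < 4 * B.hmin - (4 * B.smax ^ 2 + 4 * B.A2) *
      (2 * B.smax * (π * (ρ₂ / (Real.sqrt 2 * B.umin))) + ρ₂))
    (hH4 : 2 * umklappRadius μ + ρ₂ < 2 * π) :
    volume {θ ∈ Icc θ₀ (θ₀ + 2 * π) | |eps2 (bandX μ θ - w₁) (bandY μ θ - w₂) - μ| ≤ δ} ≤
      ENNReal.ofReal (3 * (2 * π / ℓ + 25)) * ENNReal.ofReal (δ / lam) +
      12 * ENNReal.ofReal (6 * Real.sqrt (δ / (4 * B.hmin - (4 * B.smax ^ 2 + 4 * B.A2) *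
        (2 * B.smax * (π * (ρ₂ / (Real.sqrt 2 * B.umin))) + ρ₂)))) := by
  classical
  obtain ⟨h1, h2⟩ := B.level hμ
  have hπ := Real.pi_pos
  set cc := 4 * B.hmin - (4 * B.smax ^ 2 + 4 * B.A2) *
    (2 * B.smax * (π * (ρ₂ / (Real.sqrt 2 * B.umin))) + ρ₂) with hcc
  set G : ℝ → ℝ := fun t => eps2 (bandX μ t - w₁) (bandY μ t - w₂) - μ with hG
  set G' : ℝ → ℝ := fun t =>
    2 * (Real.sin (bandX μ t - w₁) * bandVX μ t + Real.sin (bandY μ t - w₂) * bandVY μ t) with hG'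
  have hGd : ∀ t, HasDerivAt G (G' t) t := fun t => (klst_hasDerivAt_transLevel h1 h2 w₁ w₂ t).sub_const μ
  set Λ := 2 * lam with hΛ
  have hΛ0 : 0 < Λ := by positivity
  have hδΛ : δ / Λ = δ / (2 * lam) := rfl
  set P := Icc θ₀ (θ₀ + 2 * π) with hP
  set T := {θ ∈ P | |G θ| ≤ δ} with hT
  -- zeros of three periods
  have hconv : (4 * B.smax ^ 2 + 4 * B.A2) * (2 * B.smax * (π * (ρ₂ / (Real.sqrt 2 * B.umin))) + ρ₂) <
      4 * B.hmin := by linarith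
  have hcount : ∀ θ₁ : ℝ, ∃ Z : Finset ℝ, (Z.card : ℝ) ≤ 2 * π / ℓ + 25 ∧
      ∀ z ∈ Icc θ₁ (θ₁ + 2 * π), eps2 (bandX μ z - w₁) (bandY μ z - w₂) = μ → z ∈ Z :=
    fun θ₁ => klsd_zeros_card_le_awayFromCooper B hμ hlo₁ hhi₁ hℓ hηℓ hv hH1c hρ₂c hσ hconv hH4
  choose Zp hZp_card hZp_mem using hcount
  set Z₃ : Finset ℝ := Zp (θ₀ - 2 * π) ∪ Zp θ₀ ∪ Zp (θ₀ + 2 * π) with hZ₃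
  have hZ₃card : (Z₃.card : ℝ) ≤ 3 * (2 * π / ℓ + 25) := by
    have hc1 := Finset.card_union_le (Zp (θ₀ - 2 * π) ∪ Zp θ₀) (Zp (θ₀ + 2 * π))
    have hc2 := Finset.card_union_le (Zp (θ₀ - 2 * π)) (Zp θ₀)
    have e1 : ((Zp (θ₀ - 2 * π) ∪ Zp θ₀ ∪ Zp (θ₀ + 2 * π)).card : ℝ) ≤
        ((Zp (θ₀ - 2 * π) ∪ Zp θ₀).card : ℝ) + (Zp (θ₀ + 2 * π)).card := by exact_mod_cast hc1
    have e2 : ((Zp (θ₀ - 2 * π) ∪ Zp θ₀).card : ℝ) ≤ (Zp (θ₀ - 2 * π)).card + (Zp θ₀).card := by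
      exact_mod_cast hc2
    linarith [hZp_card (θ₀ - 2 * π), hZp_card θ₀, hZp_card (θ₀ + 2 * π)]
  have hZ₃mem : ∀ c ∈ Icc (θ₀ - 2 * π) (θ₀ + 4 * π), G c = 0 → c ∈ Z₃ := by
    intro c hc hGc
    have hGc' : eps2 (bandX μ c - w₁) (bandY μ c - w₂) = μ := by
      have : eps2 (bandX μ c - w₁) (bandY μ c - w₂) - μ = 0 := hGc
      linarith
    rw [hZ₃]
    rcases le_or_gt c θ₀ with hc0 | hc0
    · exact Finset.mem_union_left _ (Finset.mem_union_left _
        (hZp_mem _ c ⟨hc.1, by linarith⟩ hGc'))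
    · rcases le_or_gt c (θ₀ + 2 * π) with hc1 | hc1
      · exact Finset.mem_union_left _ (Finset.mem_union_right _ (hZp_mem _ c ⟨hc0.le, hc1⟩ hGc'))
      · exact Finset.mem_union_right _ (hZp_mem _ c ⟨hc1.le, by linarith [hc.2]⟩ hGc')
  -- good and bad points
  set Tgood := {θ ∈ P | |G θ| ≤ δ ∧ ∀ t, |t - θ| ≤ δ / Λ → |G t| ≤ δ → Λ ≤ |G' t|} with hTgood
  set Tbad := {θ ∈ P | |G θ| ≤ δ ∧ ∃ t, |t - θ| ≤ δ / Λ ∧ |G t| ≤ δ ∧ |G' t| < Λ} with hTbad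
  have hsplit : T ⊆ Tgood ∪ Tbad := by
    intro θ hθ
    by_cases hgood : ∀ t, |t - θ| ≤ δ / Λ → |G t| ≤ δ → Λ ≤ |G' t|
    · exact Or.inl ⟨hθ.1, hθ.2, hgood⟩
    · push Not at hgood
      obtain ⟨t, ht1, ht2, ht3⟩ := hgood
      exact Or.inr ⟨hθ.1, hθ.2, t, ht1, ht2, ht3⟩
  -- the good part: balls around the zeros of three periods
  have hgood_cover : Tgood ⊆ ⋃ c ∈ Z₃, Icc (c - δ / Λ) (c + δ / Λ) := by
    intro θ hθ
    obtain ⟨hθP, hGθ, hsl⟩ := hθ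
    obtain ⟨c, hθc, hGc⟩ := klsg_exists_zero_near hGd hΛ0 hGθ hsl
    have hr : δ / Λ ≤ 2 * π := by rw [hδΛ]; exact hδl
    have hcI : c ∈ Icc (θ₀ - 2 * π) (θ₀ + 4 * π) := by
      rw [abs_le] at hθc; constructor <;> linarith [hθP.1, hθP.2, hθc.1, hθc.2]
    have hcZ := hZ₃mem c hcI hGc
    simp only [mem_iUnion, mem_Icc, exists_prop]
    refine ⟨c, hcZ, ?_, ?_⟩
    · have := (abs_le.1 hθc).1; linarith
    · have := (abs_le.1 hθc).2; linarith
  have hgood_vol : volume Tgood ≤ ENNReal.ofReal (3 * (2 * π / ℓ + 25)) * ENNReal.ofReal (δ / lam) := by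
    refine (measure_mono hgood_cover).trans ((measure_biUnion_finset_le _ _).trans ?_)
    have hvol : ∀ c : ℝ, volume (Icc (c - δ / Λ) (c + δ / Λ)) = ENNReal.ofReal (δ / lam) := by
      intro c; rw [Real.volume_Icc]; congr 1; rw [hδΛ]; field_simp; ring
    simp only [hvol, Finset.sum_const, nsmul_eq_mul]
    gcongr
    have h0 : (0 : ℝ) ≤ 3 * (2 * π / ℓ + 25) := by positivity
    calc (Z₃.card : ℝ≥0∞) = ENNReal.ofReal (Z₃.card : ℝ) := by simp
      _ ≤ ENNReal.ofReal (3 * (2 * π / ℓ + 25)) := ENNReal.ofReal_le_ofReal hZ₃card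
  -- the bad part: caustic windows of the four translates in reach
  set n₁ : ℤ := ⌊w₁ / (2 * π)⌋ with hn₁
  set n₂ : ℤ := ⌊w₂ / (2 * π)⌋ with hn₂
  set Mfin : Finset (ℤ × ℤ) := ({n₁, n₁ + 1} : Finset ℤ) ×ˢ ({n₂, n₂ + 1} : Finset ℤ) with hMfin
  have hMcard : Mfin.card ≤ 4 := by
    rw [hMfin, Finset.card_product]
    calc ({n₁, n₁ + 1} : Finset ℤ).card * ({n₂, n₂ + 1} : Finset ℤ).card ≤ 2 * 2 :=
          Nat.mul_le_mul Finset.card_le_two Finset.card_le_two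
      _ = 4 := by norm_num
  set V : ℤ × ℤ → Set ℝ := fun m => {z ∈ Icc θ₀ (θ₀ + 2 * π) |
      |eps2 (bandX μ z - w₁) (bandY μ z - w₂) - μ| ≤ δ ∧
      max |2 * bandX μ z - (w₁ - m.1 * (2 * π))| |2 * bandY μ z - (w₂ - m.2 * (2 * π))| ≤ ρ₂} with hV
  have hVvol : ∀ m : ℤ × ℤ, volume (V m) ≤ 3 * ENNReal.ofReal (6 * Real.sqrt (δ / cc)) :=
    fun m => klsg_window_volume_le B hμ m.1 m.2 hδ hσ hc
  have hbad_cover : Tbad ⊆ ⋃ m ∈ Mfin, V m := by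
    intro θ hθ
    obtain ⟨hθP, hGθ, t, htθ, hGt, hG't⟩ := hθ
    have hG't' : |Real.sin (bandX μ t - w₁) * bandVX μ t + Real.sin (bandY μ t - w₂) * bandVY μ t| ≤ lam := by
      have : |G' t| = 2 * |Real.sin (bandX μ t - w₁) * bandVX μ t +
          Real.sin (bandY μ t - w₂) * bandVY μ t| := by
        show |2 * (Real.sin (bandX μ t - w₁) * bandVX μ t + Real.sin (bandY μ t - w₂) * bandVY μ t)| = _
        rw [abs_mul, abs_two]
      rw [this] at hG't
      linarith
    obtain ⟨m₀, m₁, hm⟩ := klsg_nearTangent_near_caustic B hμ hlo hhi hv hH1 (hGt.trans hδη) hG't'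
    -- `2p(θ)` is within `ρ₂` of the same translate
    have hLX := abs_bandX_sub_le B hμ θ t
    have hLY := abs_bandY_sub_le B hμ θ t
    have hθt : |θ - t| ≤ δ / (2 * lam) := by rw [abs_sub_comm]; exact htθ
    have hθw : max |2 * bandX μ θ - (w₁ - m₀ * (2 * π))| |2 * bandY μ θ - (w₂ - m₁ * (2 * π))| ≤ ρ₂ := by
      obtain ⟨hmX1, hmX2⟩ := abs_le.1 ((le_max_left _ _).trans hm)
      obtain ⟨hmY1, hmY2⟩ := abs_le.1 ((le_max_right _ _).trans hm)
      obtain ⟨hLX1, hLX2⟩ := abs_le.1 (hLX.trans (mul_le_mul_of_nonneg_left hθt B.smax_pos.le))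
      obtain ⟨hLY1, hLY2⟩ := abs_le.1 (hLY.trans (mul_le_mul_of_nonneg_left hθt B.smax_pos.le))
      refine max_le ?_ ?_ <;> (rw [abs_le]; constructor <;> linarith [hρ₂])
    -- the translate is one of the four in reach
    have h2π : (0 : ℝ) < 2 * π := by positivity
    have hnear : ∀ (wc X : ℝ) (n : ℤ), |X| ≤ umklappRadius μ → |2 * X - (wc - n * (2 * π))| ≤ ρ₂ →
        |wc / (2 * π) - n| < 1 := by
      intro wc X n hX hwX
      obtain ⟨hX1, hX2⟩ := abs_le.1 hX
      obtain ⟨hw1, hw2⟩ := abs_le.1 hwX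
      have hlt : |wc - n * (2 * π)| < 2 * π := by
        rw [abs_lt]; constructor <;> linarith
      have e : wc / (2 * π) - n = (wc - n * (2 * π)) / (2 * π) := by field_simp
      rw [e, abs_div, abs_of_pos h2π, div_lt_one h2π]
      exact hlt
    have hm₀ : m₀ ∈ ({n₁, n₁ + 1} : Finset ℤ) :=
      klsd_int_mem_pair_of_abs_sub_lt_one
        (hnear w₁ (bandX μ θ) m₀ (abs_bandX_le_umklappRadius h1 h2 θ) ((le_max_left _ _).trans hθw))
    have hm₁ : m₁ ∈ ({n₂, n₂ + 1} : Finset ℤ) :=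
      klsd_int_mem_pair_of_abs_sub_lt_one
        (hnear w₂ (bandY μ θ) m₁ (abs_bandY_le_umklappRadius h1 h2 θ) ((le_max_right _ _).trans hθw))
    have hmM : (m₀, m₁) ∈ Mfin := Finset.mem_product.2 ⟨hm₀, hm₁⟩
    simp only [mem_iUnion, exists_prop]
    exact ⟨(m₀, m₁), hmM, hθP, hGθ, hθw⟩
  have hbad_vol : volume Tbad ≤ 12 * ENNReal.ofReal (6 * Real.sqrt (δ / cc)) := by
    refine (measure_mono hbad_cover).trans ((measure_biUnion_finset_le _ _).trans ?_)
    calc ∑ m ∈ Mfin, volume (V m) ≤ ∑ _m ∈ Mfin, 3 * ENNReal.ofReal (6 * Real.sqrt (δ / cc)) :=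
          Finset.sum_le_sum (fun m _ => hVvol m)
      _ = Mfin.card * (3 * ENNReal.ofReal (6 * Real.sqrt (δ / cc))) := by
          rw [Finset.sum_const, nsmul_eq_mul]
      _ ≤ 4 * (3 * ENNReal.ofReal (6 * Real.sqrt (δ / cc))) := by
          gcongr; exact_mod_cast hMcard
      _ = 12 * ENNReal.ofReal (6 * Real.sqrt (δ / cc)) := by ring
  calc volume T ≤ volume (Tgood ∪ Tbad) := measure_mono hsplit
    _ ≤ volume Tgood + volume Tbad := measure_union_le _ _
    _ ≤ _ := add_le_add hgood_vol hbad_vol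

end Main

end Summit.HubbardSuperconductivity.HubbardSuperconductivity.Theorems

end
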